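import Mathlib
import HarnessLib

/-!
# Route `PoloidalWindowDoor`, item `LrcModEntire` (stmt-NavierStokesRegularity-20428) / crux K2 (stmt-19708) —
# STRICT MAXIMUM AT A QUARTIC-NONDEGENERATE FLAT CRITICAL POINT (the leaf geometry of the flat thick residue S3′, case (a))

LEAD of item 20428 ns-poloidal-K2-p3 g10 (`--supports stmt-NavierStokesRegularity-20428 --as helper`).
At a FLAT threaded hot spot (thread_axis S3′) the slice `g = v₂(−1,·)` has, along the flat horizontal direction `q` and its horizontal
perpendicular `p`: `Dg(0) = 0`, `D²g(0)[q,·] = 0`, `A := D²g(0)[p,p] ≤ 0`, `D³g(0)[q,q,q] = 0`, `Q := D⁴g(0)[q,q,q,q]` signed (tree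
`…ThreadFlatHotSpot.flatHotSpotPins`).  In the QUARTIC-NONDEGENERATE case `A < 0`, `Q < 0`, `3B² < AQ` (`B := D³g(0)[p,q,q]`, here spelled
`(d²/dy²) Dg(yq)p |₀`) the point is still a STRICT local maximum of `g` on the plane `span(p,q)` — weighted expansion
`g(xp + yq) − g(0) = ½A x² + ½B x y² + (Q/24) y⁴ + o(x² + y⁴)`, a negative-definite form in `(x, y²)`.  Proof WITHOUT multivariable Taylor:
Lagrange in `x` at order 2 for each `y` + one-variable Taylor (`taylor_isLittleO_univ`) for `y ↦ g(yq)` (order 4) and `y ↦ Dg(yq)p` (order 2)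
+ continuity of `D²g`.  General real normed space.
* `taylor_two_lagrange`, `taylor_littleO_two`, `taylor_littleO_four` — one-variable Taylor tools;
* `deriv2_affineLine`, `abs_hessian_apply_sub_le` — line/diagonal bookkeeping;
* `quarticMax` — the theorem.
WHAT THIS IS NOT: not S3′, not a claim about Navier–Stokes regularity — calculus (bears_on LADDER-NS N0, rung N0-LocalTubeDoorPoloidal). [folklore]
-/

noncomputable section

-- the summit and its single sub-problem share the name (CONVENTIONS §1), as in every Theorems file
set_option linter.dupNamespace false

namespace Summit.NavierStokesRegularity.NavierStokesRegularity.Theorems.PoloidalWindowDoorLrcModEntireQuarticMax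

open Set Filter Topology Metric Asymptotics

/-! ### One-variable Taylor tools -/

/-- Lagrange form at order two about `0`: `f x = f 0 + f'(0) x + f''(ξ) x²/2` for some `ξ` strictly between `0` and `x`. [folklore] -/
theorem taylor_two_lagrange {f : ℝ → ℝ} (hf : ContDiff ℝ 2 f) {x : ℝ} (hx : x ≠ 0) :
    ∃ ξ ∈ uIoo 0 x, f x = f 0 + deriv f 0 * x + iteratedDeriv 2 f ξ * x ^ 2 / 2 := by
  obtain ⟨ξ, hξ, h⟩ := taylor_mean_remainder_lagrange_iteratedDeriv (n := 1) hx.symm (hf.contDiffOn)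
  refine ⟨ξ, hξ, ?_⟩
  have hT : taylorWithinEval f 1 (uIcc 0 x) 0 x = f 0 + deriv f 0 * x := by
    rw [taylor_within_apply]
    simp only [Finset.sum_range_succ, Finset.sum_range_zero, Nat.factorial, sub_zero, iteratedDerivWithin_zero,
      iteratedDerivWithin_one, zero_add, pow_zero, pow_one, Nat.cast_one, inv_one, mul_one, smul_eq_mul]
    have hU : UniqueDiffWithinAt ℝ (uIcc 0 x) 0 :=
      uniqueDiffOn_Icc (by rcases lt_or_gt_of_ne hx with h | h <;> simp [h.le, h]) 0 left_mem_uIcc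
    rw [(hf.differentiable (by norm_num) 0).derivWithin hU]
    ring
  rw [hT] at h
  have : f x = f 0 + deriv f 0 * x + iteratedDeriv 2 f ξ * (x - 0) ^ 2 / (1 + 1).factorial := by linarith
  rw [this]
  norm_num [Nat.factorial]

/-- Second-order little-o Taylor about `0` with `f'(0) = 0`: `|f y − f 0 − f''(0) y²/2| ≤ ε y²` near `0`. [folklore] -/
theorem taylor_littleO_two {f : ℝ → ℝ} (hf : ContDiff ℝ 2 f) (h1 : deriv f 0 = 0) {ε : ℝ} (hε : 0 < ε) :
    ∃ δ > 0, ∀ y : ℝ, |y| < δ → |f y - f 0 - iteratedDeriv 2 f 0 * y ^ 2 / 2| ≤ ε * y ^ 2 := by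
  have hT : ∀ y : ℝ, taylorWithinEval f 2 univ 0 y = f 0 + iteratedDeriv 2 f 0 * y ^ 2 / 2 := by
    intro y
    rw [taylor_within_apply]
    simp only [Finset.sum_range_succ, Finset.sum_range_zero, Nat.factorial, sub_zero, iteratedDerivWithin_univ,
      iteratedDeriv_zero, iteratedDeriv_one, h1, smul_eq_mul]
    norm_num
    ring
  have hlo := (taylor_isLittleO_univ (n := 2) (x₀ := 0) hf).def hε
  obtain ⟨δ, hδ, hball⟩ := Metric.eventually_nhds_iff.1 hlo
  refine ⟨δ, hδ, fun y hy => ?_⟩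
  have h := hball (show dist y 0 < δ by simpa using hy)
  rw [hT, ← sub_sub] at h
  simpa [Real.norm_eq_abs, sub_zero, abs_pow, sq_abs] using h

/-- Fourth-order little-o Taylor about `0` with `f'(0) = f''(0) = f'''(0) = 0`: `|f y − f 0 − f⁗(0) y⁴/24| ≤ ε y⁴` near `0`. [folklore] -/
theorem taylor_littleO_four {f : ℝ → ℝ} (hf : ContDiff ℝ 4 f) (h1 : deriv f 0 = 0)
    (h2 : iteratedDeriv 2 f 0 = 0) (h3 : iteratedDeriv 3 f 0 = 0) {ε : ℝ} (hε : 0 < ε) :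
    ∃ δ > 0, ∀ y : ℝ, |y| < δ → |f y - f 0 - iteratedDeriv 4 f 0 * y ^ 4 / 24| ≤ ε * y ^ 4 := by
  have hT : ∀ y : ℝ, taylorWithinEval f 4 univ 0 y = f 0 + iteratedDeriv 4 f 0 * y ^ 4 / 24 := by
    intro y
    rw [taylor_within_apply]
    simp only [Finset.sum_range_succ, Finset.sum_range_zero, Nat.factorial, sub_zero, iteratedDerivWithin_univ,
      iteratedDeriv_zero, iteratedDeriv_one, h1, h2, h3, smul_eq_mul]
    norm_num
    ring
  have hlo := (taylor_isLittleO_univ (n := 4) (x₀ := 0) hf).def hε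
  obtain ⟨δ, hδ, hball⟩ := Metric.eventually_nhds_iff.1 hlo
  refine ⟨δ, hδ, fun y hy => ?_⟩
  have h := hball (show dist y 0 < δ by simpa using hy)
  rw [hT, ← sub_sub] at h
  have h4 : |y| ^ 4 = y ^ 4 := by rw [← abs_pow, abs_of_nonneg (by positivity)]
  simpa [Real.norm_eq_abs, sub_zero, abs_pow, h4] using h

/-! ### Line bookkeeping in a real normed space -/

section Line

variable {E : Type*} [NormedAddCommGroup E] [NormedSpace ℝ E]

/-- Along the affine line `s ↦ s p + y q`: `d²/ds² g(sp + yq) = D²g(sp + yq)[p,p]` for `g ∈ C²`. [folklore] -/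
theorem deriv2_affineLine {g : E → ℝ} (hg : ContDiff ℝ 2 g) (p q : E) (y x : ℝ) :
    deriv (deriv (fun s : ℝ => g (s • p + y • q))) x = iteratedFDeriv ℝ 2 g (x • p + y • q) ![p, p] := by
  have hd : Differentiable ℝ g := hg.differentiable (by norm_num)
  have hd2 : Differentiable ℝ (fderiv ℝ g) := (hg.fderiv_right (m := 1) (by norm_num)).differentiable (by norm_num)
  have hline : ∀ s : ℝ, HasDerivAt (fun s : ℝ => s • p + y • q) p s := fun s => by
    simpa using ((hasDerivAt_id s).smul_const p).add_const (y • q)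
  have h1 : deriv (fun s : ℝ => g (s • p + y • q)) = fun s => fderiv ℝ g (s • p + y • q) p :=
    funext fun s => ((hd _).hasFDerivAt.comp_hasDerivAt s (hline s)).deriv
  rw [h1]
  have hc : HasDerivAt (fun s : ℝ => fderiv ℝ g (s • p + y • q)) (fderiv ℝ (fderiv ℝ g) (x • p + y • q) p) x :=
    (hd2 _).hasFDerivAt.comp_hasDerivAt x (hline x)
  rw [(hc.clm_apply (hasDerivAt_const x p)).deriv, iteratedFDeriv_two_apply]
  simp

/-- `y ↦ Dg(yq)p` has derivative `D²g(yq)[q,p]`. [folklore] -/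
theorem hasDerivAt_fderiv_line_apply {g : E → ℝ} (hg : ContDiff ℝ 2 g) (p q : E) (y : ℝ) :
    HasDerivAt (fun y : ℝ => fderiv ℝ g (y • q) p) (iteratedFDeriv ℝ 2 g (y • q) ![q, p]) y := by
  have hd2 : Differentiable ℝ (fderiv ℝ g) := (hg.fderiv_right (m := 1) (by norm_num)).differentiable (by norm_num)
  have hline : HasDerivAt (fun y : ℝ => y • q) q y := by simpa using (hasDerivAt_id y).smul_const q
  have hc : HasDerivAt (fun y : ℝ => fderiv ℝ g (y • q)) (fderiv ℝ (fderiv ℝ g) (y • q) q) y :=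
    (hd2 _).hasFDerivAt.comp_hasDerivAt y hline
  have h := hc.clm_apply (hasDerivAt_const y p)
  rw [iteratedFDeriv_two_apply]
  simpa using h

/-- `dᵏ/dyᵏ g(yq)|₀ = Dᵏg(0)[q,…,q]`. [folklore] -/
theorem iteratedDeriv_line {g : E → ℝ} {n : ℕ} (hg : ContDiff ℝ n g) (q : E) {k : ℕ} (hk : k ≤ n) :
    iteratedDeriv k (fun y : ℝ => g (y • q)) 0 = iteratedFDeriv ℝ k g 0 (fun _ => q) := by
  set L : ℝ →L[ℝ] E := ContinuousLinearMap.toSpanSingleton ℝ q with hL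
  have hfun : (fun y : ℝ => g (y • q)) = g ∘ L := by
    funext y; simp [hL, ContinuousLinearMap.toSpanSingleton_apply]
  rw [hfun, iteratedDeriv_eq_iteratedFDeriv, L.iteratedFDeriv_comp_right hg 0 (by exact_mod_cast hk),
    ContinuousMultilinearMap.compContinuousLinearMap_apply]
  simp [hL, ContinuousLinearMap.toSpanSingleton_apply]

/-- Op-norm control of the Hessian quadratic form in the base point. [folklore] -/
theorem abs_hessian_apply_sub_le (g : E → ℝ) (z p : E) :
    |iteratedFDeriv ℝ 2 g z ![p, p] - iteratedFDeriv ℝ 2 g 0 ![p, p]| ≤ ‖iteratedFDeriv ℝ 2 g z - iteratedFDeriv ℝ 2 g 0‖ * ‖p‖ ^ 2 := by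
  have h := (iteratedFDeriv ℝ 2 g z - iteratedFDeriv ℝ 2 g 0).le_opNorm ![p, p]
  simp only [sub_apply, Fin.prod_univ_two, Matrix.cons_val_zero, Matrix.cons_val_one, Real.norm_eq_abs] at h
  simpa [sq] using h

/-- Between `0` and `x` means smaller in absolute value. -/
theorem abs_lt_of_mem_uIoo {ξ x : ℝ} (h : ξ ∈ uIoo 0 x) : |ξ| < |x| := by
  rcases le_or_gt 0 x with hx | hx
  · rw [uIoo_of_le hx] at h
    rw [abs_of_pos h.1, abs_of_nonneg hx]; exact h.2
  · rw [uIoo_of_ge hx.le] at h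
    rw [abs_of_neg h.2, abs_of_neg hx]; linarith [h.1]

/-- A negative-definite binary form is negative off the origin (here on `X > 0`, `Y ≥ 0`). [folklore] -/
theorem form_neg_of_negdef {a b c X Y : ℝ} (ha : a < 0) (hD : 0 < 4 * a * c - b ^ 2) (hX : 0 < X) (hY : 0 ≤ Y) :
    a * X ^ 2 + b * (X * Y) + c * Y ^ 2 < 0 := by
  have hid : 4 * a * (a * X ^ 2 + b * (X * Y) + c * Y ^ 2) = (2 * a * X + b * Y) ^ 2 + (4 * a * c - b ^ 2) * Y ^ 2 := by
    ring
  rcases eq_or_lt_of_le hY with hY0 | hYpos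
  · rw [← hY0]
    have : a * X ^ 2 < 0 := mul_neg_of_neg_of_pos ha (pow_pos hX 2)
    simpa using this
  · have hpos : 0 < (2 * a * X + b * Y) ^ 2 + (4 * a * c - b ^ 2) * Y ^ 2 :=
      add_pos_of_nonneg_of_pos (sq_nonneg _) (mul_pos hD (pow_pos hYpos 2))
    by_contra hnot
    push Not at hnot
    have hprod : 0 ≤ (-(4 * a)) * (a * X ^ 2 + b * (X * Y) + c * Y ^ 2) := mul_nonneg (by linarith) hnot
    linarith [hid, hpos, hprod]

/-- The margin: from `A < 0`, `Q < 0`, `3B² < AQ` an `ε > 0` keeping the perturbed form negative definite. [folklore] -/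
theorem exists_margin {A B Q : ℝ} (hA : A < 0) (hQ : Q < 0) (hdisc : 3 * B ^ 2 < A * Q) :
    ∃ ε > 0, 0 < 4 * ((A + ε) / 2) * (Q / 24 + ε) - (|B| / 2 + ε) ^ 2 ∧ A + ε < 0 ∧ Q / 24 + ε < 0 := by
  have hΦc : Continuous fun e : ℝ => 4 * ((A + e) / 2) * (Q / 24 + e) - (|B| / 2 + e) ^ 2 := by fun_prop
  have hΦ0 : (0 : ℝ) < 4 * ((A + 0) / 2) * (Q / 24 + 0) - (|B| / 2 + 0) ^ 2 := by
    have hB2 : |B| ^ 2 = B ^ 2 := sq_abs B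
    nlinarith [hdisc, hB2]
  have hev : ∀ᶠ e in 𝓝 (0 : ℝ),
      (0 < 4 * ((A + e) / 2) * (Q / 24 + e) - (|B| / 2 + e) ^ 2) ∧ (A + e < 0 ∧ Q / 24 + e < 0) := by
    refine (continuousAt_const.eventually_lt hΦc.continuousAt hΦ0).and (Filter.Eventually.and ?_ ?_)
    · exact (by fun_prop : Continuous fun e : ℝ => A + e).continuousAt.eventually_lt continuousAt_const
        (by simpa using hA)
    · exact (by fun_prop : Continuous fun e : ℝ => Q / 24 + e).continuousAt.eventually_lt continuousAt_const
        (by simp only [add_zero]; linarith)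
  obtain ⟨r, hr, hrball⟩ := Metric.eventually_nhds_iff.1 hev
  have hεr : dist (r / 2) 0 < r := by rw [Real.dist_eq, sub_zero, abs_of_pos (by linarith)]; linarith
  exact ⟨r / 2, by linarith, hrball hεr⟩

/-- Upper semicontinuity-type control of the Hessian quadratic form near `0` for `g ∈ C²`. [folklore] -/
theorem hessian_apply_le_near {g : E → ℝ} (hg : ContDiff ℝ 2 g) (p : E) {ε : ℝ} (hε : 0 < ε) :
    ∃ η > 0, ∀ z : E, ‖z‖ < η → iteratedFDeriv ℝ 2 g z ![p, p] ≤ iteratedFDeriv ℝ 2 g 0 ![p, p] + ε := by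
  have hcont : Continuous fun z => iteratedFDeriv ℝ 2 g z := hg.continuous_iteratedFDeriv le_rfl
  obtain ⟨η, hη, hηball⟩ := Metric.continuousAt_iff.1 (hcont.continuousAt (x := (0 : E))) (ε / (‖p‖ ^ 2 + 1))
    (by positivity)
  refine ⟨η, hη, fun z hz => ?_⟩
  have hd : ‖iteratedFDeriv ℝ 2 g z - iteratedFDeriv ℝ 2 g 0‖ < ε / (‖p‖ ^ 2 + 1) := by
    have h := hηball (show dist z 0 < η by simpa using hz)
    rwa [dist_eq_norm] at h
  have hle := abs_hessian_apply_sub_le g z p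
  have hp2 : (0 : ℝ) ≤ ‖p‖ ^ 2 := by positivity
  have h2 : ‖iteratedFDeriv ℝ 2 g z - iteratedFDeriv ℝ 2 g 0‖ * ‖p‖ ^ 2 ≤ ε := by
    calc ‖iteratedFDeriv ℝ 2 g z - iteratedFDeriv ℝ 2 g 0‖ * ‖p‖ ^ 2 ≤ ε / (‖p‖ ^ 2 + 1) * ‖p‖ ^ 2 :=
          mul_le_mul_of_nonneg_right hd.le hp2
      _ ≤ ε := by
          rw [div_mul_eq_mul_div, div_le_iff₀ (by positivity)]
          nlinarith [hε]
  have := (abs_le.1 (hle.trans h2)).2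
  linarith

/-- Lagrange expansion in `x` along `p` at height `y q`: `g(xp + yq) = g(yq) + Dg(yq)p·x + D²g(ξp + yq)[p,p]·x²/2`. [folklore] -/
theorem lagrange_along {g : E → ℝ} (hg : ContDiff ℝ 2 g) (p q : E) (y : ℝ) {x : ℝ} (hx : x ≠ 0) :
    ∃ ξ ∈ uIoo 0 x, g (x • p + y • q) =
      g (y • q) + fderiv ℝ g (y • q) p * x + iteratedFDeriv ℝ 2 g (ξ • p + y • q) ![p, p] * x ^ 2 / 2 := by
  have hfc : ContDiff ℝ 2 (fun s : ℝ => g (s • p + y • q)) :=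
    hg.comp ((contDiff_id.smul contDiff_const).add contDiff_const)
  obtain ⟨ξ, hξ, hL⟩ := taylor_two_lagrange hfc hx
  refine ⟨ξ, hξ, ?_⟩
  have hfd : deriv (fun s : ℝ => g (s • p + y • q)) 0 = fderiv ℝ g (y • q) p := by
    have hline : HasDerivAt (fun s : ℝ => s • p + y • q) p 0 := by
      simpa using ((hasDerivAt_id (0 : ℝ)).smul_const p).add_const (y • q)
    have h : HasDerivAt (fun s : ℝ => g (s • p + y • q)) (fderiv ℝ g ((0 : ℝ) • p + y • q) p) 0 :=
      ((hg.differentiable (by norm_num)) (((0 : ℝ) • p + y • q))).hasFDerivAt.comp_hasDerivAt (0 : ℝ) hline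
    rw [h.deriv]
    simp
  have hf2 : iteratedDeriv 2 (fun s : ℝ => g (s • p + y • q)) ξ = iteratedFDeriv ℝ 2 g (ξ • p + y • q) ![p, p] := by
    have e2 : iteratedDeriv 2 (fun s : ℝ => g (s • p + y • q)) = deriv (deriv fun s : ℝ => g (s • p + y • q)) := by
      rw [iteratedDeriv_succ, iteratedDeriv_one]
    rw [e2]
    exact deriv2_affineLine hg p q y ξ
  simp only [zero_smul, zero_add] at hL
  rw [hfd, hf2] at hL
  exact hL

/-- Jets of the line functions at a flat critical point: `y ↦ g(yq)` has vanishing first three derivatives at `0` and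
`y ↦ Dg(yq)p` is `C²` with vanishing first derivative at `0`. [folklore] -/
theorem line_jets {g : E → ℝ} (hg : ContDiff ℝ 4 g) (p q : E) (h1 : fderiv ℝ g 0 = 0)
    (hker : ∀ w : E, iteratedFDeriv ℝ 2 g 0 ![q, w] = 0) (h3 : iteratedFDeriv ℝ 3 g 0 (fun _ => q) = 0) :
    (deriv (fun y : ℝ => g (y • q)) 0 = 0 ∧ iteratedDeriv 2 (fun y : ℝ => g (y • q)) 0 = 0 ∧
      iteratedDeriv 3 (fun y : ℝ => g (y • q)) 0 = 0 ∧
      iteratedDeriv 4 (fun y : ℝ => g (y • q)) 0 = iteratedFDeriv ℝ 4 g 0 (fun _ => q)) ∧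
    (ContDiff ℝ 2 (fun y : ℝ => fderiv ℝ g (y • q) p) ∧ deriv (fun y : ℝ => fderiv ℝ g (y • q) p) 0 = 0) := by
  have hg2 : ContDiff ℝ 2 g := hg.of_le (by norm_num)
  have hline1 : ∀ k : ℕ, k ≤ 4 → iteratedDeriv k (fun y : ℝ => g (y • q)) 0 = iteratedFDeriv ℝ k g 0 (fun _ => q) :=
    fun k hk => iteratedDeriv_line hg q hk
  refine ⟨⟨?_, ?_, ?_, hline1 4 le_rfl⟩, ?_, ?_⟩
  · rw [← iteratedDeriv_one, hline1 1 (by norm_num), iteratedFDeriv_one_apply, h1, zero_apply]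
  · rw [hline1 2 (by norm_num)]
    have hqq : (fun _ : Fin 2 => q) = ![q, q] := by funext i; fin_cases i <;> simp
    rw [hqq]; exact hker q
  · rw [hline1 3 (by norm_num)]; exact h3
  · exact ((hg.fderiv_right (m := 2) (by norm_num)).comp (contDiff_id.smul contDiff_const)).clm_apply contDiff_const
  · rw [(hasDerivAt_fderiv_line_apply hg2 p q 0).deriv, zero_smul]; exact hker p

/-- **STRICT MAXIMUM AT A QUARTIC-NONDEGENERATE FLAT CRITICAL POINT.**  `g ∈ C⁴` on a real normed space, directions `p, q`; at `0`:
`Dg(0) = 0`, `q` in the kernel of `D²g(0)`, `A := D²g(0)[p,p] < 0`, `D³g(0)[q,q,q] = 0`, `Q := D⁴g(0)[q,q,q,q] < 0`, and the discriminant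
condition `3B² < AQ` for `B := (d²/dy²)|₀ Dg(yq)p` (`= D³g(0)[p,q,q]`).  Then `0` is a STRICT local maximum of `g` on the plane spanned by
`p, q`: `g(xp + yq) < g(0)` for all small `(x,y) ≠ (0,0)`. [folklore] -/
theorem quarticMax {g : E → ℝ} (hg : ContDiff ℝ 4 g) (p q : E) (h1 : fderiv ℝ g 0 = 0)
    (hker : ∀ w : E, iteratedFDeriv ℝ 2 g 0 ![q, w] = 0) (hA : iteratedFDeriv ℝ 2 g 0 ![p, p] < 0)
    (h3 : iteratedFDeriv ℝ 3 g 0 (fun _ => q) = 0) (hQ : iteratedFDeriv ℝ 4 g 0 (fun _ => q) < 0)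
    (hdisc : 3 * (iteratedDeriv 2 (fun y : ℝ => fderiv ℝ g (y • q) p) 0) ^ 2 <
      iteratedFDeriv ℝ 2 g 0 ![p, p] * iteratedFDeriv ℝ 4 g 0 (fun _ => q)) :
    ∃ ρ > 0, ∀ x y : ℝ, |x| < ρ → |y| < ρ → (x ≠ 0 ∨ y ≠ 0) → g (x • p + y • q) < g 0 := by
  obtain ⟨A, hAdef⟩ : ∃ A, A = iteratedFDeriv ℝ 2 g 0 ![p, p] := ⟨_, rfl⟩
  obtain ⟨Q, hQdef⟩ : ∃ Q, Q = iteratedFDeriv ℝ 4 g 0 (fun _ => q) := ⟨_, rfl⟩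
  obtain ⟨B, hBdef⟩ : ∃ B, B = iteratedDeriv 2 (fun y : ℝ => fderiv ℝ g (y • q) p) 0 := ⟨_, rfl⟩
  rw [← hAdef] at hA hdisc
  rw [← hQdef] at hQ hdisc
  rw [← hBdef] at hdisc
  have hg2 : ContDiff ℝ 2 g := hg.of_le (by norm_num)
  -- Step 0: the margin
  obtain ⟨ε, hε, hΦε, hAε, hQε⟩ := exists_margin hA hQ hdisc
  -- Steps 1–2: jets of the line functions and their Taylor bounds
  obtain ⟨⟨hF0d1, hF0d2, hF0d3, hF0d4⟩, hF1c, hF1d1⟩ := line_jets hg p q h1 hker h3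
  rw [← hQdef] at hF0d4
  have hF0c : ContDiff ℝ 4 (fun y : ℝ => g (y • q)) := hg.comp (contDiff_id.smul contDiff_const)
  obtain ⟨δ₀, hδ₀, hT0⟩ := taylor_littleO_four hF0c hF0d1 hF0d2 hF0d3 hε
  obtain ⟨δ₁, hδ₁, hT1⟩ := taylor_littleO_two hF1c hF1d1 hε
  -- Step 3: the Hessian near `0`
  obtain ⟨η, hη, hH⟩ := hessian_apply_le_near hg2 p hε
  rw [← hAdef] at hH
  -- Step 4: the radius
  have hS : (0 : ℝ) < ‖p‖ + ‖q‖ + 1 := by positivity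
  refine ⟨min (min δ₀ δ₁) (η / (‖p‖ + ‖q‖ + 1)), lt_min (lt_min hδ₀ hδ₁) (div_pos hη hS), fun x y hx hy hxy => ?_⟩
  have hρ0 : min (min δ₀ δ₁) (η / (‖p‖ + ‖q‖ + 1)) ≤ δ₀ := (min_le_left _ _).trans (min_le_left _ _)
  have hρ1 : min (min δ₀ δ₁) (η / (‖p‖ + ‖q‖ + 1)) ≤ δ₁ := (min_le_left _ _).trans (min_le_right _ _)
  have hρη : min (min δ₀ δ₁) (η / (‖p‖ + ‖q‖ + 1)) ≤ η / (‖p‖ + ‖q‖ + 1) := min_le_right _ _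
  have hyδ₀ : |y| < δ₀ := hy.trans_le hρ0
  have hyδ₁ : |y| < δ₁ := hy.trans_le hρ1
  have hnorm : ∀ ξ : ℝ, |ξ| ≤ |x| → ‖ξ • p + y • q‖ < η := by
    intro ξ hξ
    have hxη : |x| < η / (‖p‖ + ‖q‖ + 1) := hx.trans_le hρη
    have hyη : |y| < η / (‖p‖ + ‖q‖ + 1) := hy.trans_le hρη
    have hρ' : η / (‖p‖ + ‖q‖ + 1) * (‖p‖ + ‖q‖ + 1) = η := div_mul_cancel₀ η hS.ne'
    calc ‖ξ • p + y • q‖ ≤ ‖ξ • p‖ + ‖y • q‖ := norm_add_le _ _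
      _ = |ξ| * ‖p‖ + |y| * ‖q‖ := by rw [norm_smul, norm_smul, Real.norm_eq_abs, Real.norm_eq_abs]
      _ ≤ η / (‖p‖ + ‖q‖ + 1) * ‖p‖ + η / (‖p‖ + ‖q‖ + 1) * ‖q‖ :=
          add_le_add (mul_le_mul_of_nonneg_right (hξ.trans hxη.le) (norm_nonneg _))
            (mul_le_mul_of_nonneg_right hyη.le (norm_nonneg _))
      _ < η := by
          have hpos : 0 < η / (‖p‖ + ‖q‖ + 1) := div_pos hη hS
          nlinarith [hρ', hpos]
  -- Step 5: the quartic piece at this `y`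
  have h0y : g (y • q) - g 0 ≤ (Q / 24 + ε) * y ^ 4 := by
    have h := hT0 y hyδ₀
    simp only [zero_smul, hF0d4] at h
    have := (abs_le.1 h).2
    linarith
  rcases eq_or_ne x 0 with hx0 | hx0
  · -- `x = 0`: the pure quartic direction
    subst hx0
    have hy0 : y ≠ 0 := by
      rcases hxy with h | h
      · exact absurd rfl h
      · exact h
    have hy4 : 0 < y ^ 4 := by positivity
    simp only [zero_smul, zero_add]
    nlinarith [h0y, hQε, hy4]
  · -- `x ≠ 0`: Lagrange in `x`
    obtain ⟨ξ, hξ, hL⟩ := lagrange_along hg2 p q y hx0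
    have hHb : iteratedFDeriv ℝ 2 g (ξ • p + y • q) ![p, p] ≤ A + ε := hH _ (hnorm ξ (abs_lt_of_mem_uIoo hξ).le)
    have hF1b : |fderiv ℝ g (y • q) p| ≤ |B| / 2 * y ^ 2 + ε * y ^ 2 := by
      have h := hT1 y hyδ₁
      simp only [zero_smul, h1, zero_apply, sub_zero, ← hBdef] at h
      have h' : |fderiv ℝ g (y • q) p| ≤ |B * y ^ 2 / 2| + ε * y ^ 2 := by
        have := abs_sub_abs_le_abs_sub (fderiv ℝ g (y • q) p) (B * y ^ 2 / 2)
        linarith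
      rw [abs_div, abs_mul, abs_of_nonneg (sq_nonneg y), abs_two] at h'
      linarith
    have hx2 : 0 < x ^ 2 := by positivity
    have hcross : fderiv ℝ g (y • q) p * x ≤ (|B| / 2 + ε) * (|x| * y ^ 2) := by
      have hle : fderiv ℝ g (y • q) p * x ≤ |fderiv ℝ g (y • q) p| * |x| := by
        rw [← abs_mul]; exact le_abs_self _
      have hxnn : 0 ≤ |x| := abs_nonneg x
      calc fderiv ℝ g (y • q) p * x ≤ |fderiv ℝ g (y • q) p| * |x| := hle
        _ ≤ (|B| / 2 * y ^ 2 + ε * y ^ 2) * |x| := mul_le_mul_of_nonneg_right hF1b hxnn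
        _ = (|B| / 2 + ε) * (|x| * y ^ 2) := by ring
    have hquad : iteratedFDeriv ℝ 2 g (ξ • p + y • q) ![p, p] * x ^ 2 / 2 ≤ (A + ε) / 2 * x ^ 2 := by
      have h := mul_le_mul_of_nonneg_right hHb (show (0 : ℝ) ≤ x ^ 2 / 2 by positivity)
      calc iteratedFDeriv ℝ 2 g (ξ • p + y • q) ![p, p] * x ^ 2 / 2
          = iteratedFDeriv ℝ 2 g (ξ • p + y • q) ![p, p] * (x ^ 2 / 2) := by ring
        _ ≤ (A + ε) * (x ^ 2 / 2) := h
        _ = (A + ε) / 2 * x ^ 2 := by ring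
    -- the negative-definite form in `(|x|, y²)`
    have key := form_neg_of_negdef (b := |B| / 2 + ε) (c := Q / 24 + ε) (by linarith : (A + ε) / 2 < 0)
      (by linarith [hΦε]) (abs_pos.2 hx0) (sq_nonneg y)
    rw [sq_abs] at key
    have hy4 : (y ^ 2) ^ 2 = y ^ 4 := by ring
    rw [hy4] at key
    linarith [hL, h0y, hcross, hquad, key]

end Line

end Summit.NavierStokesRegularity.NavierStokesRegularity.Theorems.PoloidalWindowDoorLrcModEntireQuarticMax
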